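import Literature.Geometry.Lorentzian.CarterThresholdTurningPointTortoise
import Literature.Geometry.Lorentzian.CarterSliverCapCoefficient
import HarnessLib

/-!
# The two collar floors of the sliver barrier of Carter's equation
(namespace `Literature.Geometry.Lorentzian.Kerr`.)

Carter's radial equation (DRSR arXiv:1402.7034 §5.2.3), `V = Kerr.sepPotential M a ω m Λ`, sliver
frequency `σ = ω − mω₊`, BF margin `(1 + θ₁)(2r₊ω)² ≤ Λ′`. Between the collar radius
`r_θ = r₊ + θ(r₊ − r₋)` and the window start `r_lo` of the far barrier the coefficient `V − ω²` has two
positive floors: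

* `negCoeff_ge_of_sliverCollar` — on `[r_θ, r₊(1 + θ₁/8)]` (the cap being inside the collar,
  `2X* ≤ r_θ − r₊`): `Δ(r_θ)θ₁Λ′/(16(r² + a²)²) ≤ V(r) − ω²` (`sq_mul_negCoeff_ge_of_sliver'`);
* `negCoeff_ge_of_layerCollar` — on `[r_ζ, r_lo]` with `r_lo ≤ r_t` (`J(r_t) = 0`) and the fuzzed
  lower profile bound `Δ(J − E) ≤ (r² + a²)²(V − ω²)` at `r`, `E ≤ J_lo`:
  `Δ(r_ζ)(J_lo − E)/(r_lo² + a²)² ≤ V(r) − ω²`, `J_lo = 2ω²(r_lo + r₊)h(r_lo)(r_t − r_lo)`.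

Inputs of `CarterLayerBarrierGeometry` (near-extremal Kerr programme, crux `KappaExplicitWaveDecay`).

## References
* M. Dafermos, I. Rodnianski, Y. Shlapentokh-Rothman, arXiv:1402.7034 = Ann. of Math. 183 (2016),
  §§5.2.3, 6.2 (key `DafermosRodnianskiShlapentokhrothman2014`). Folklore assembly.
-/

noncomputable section

open Set

namespace Literature.Geometry.Lorentzian

namespace Kerr

section LayerCollar

variable {M a ω Λ : ℝ} {m : ℤ}

/-- **Inner collar floor of the sliver barrier.** `|a| < M`, `0 < θ₁ ≤ 1`, BF margin, `Λ′ > 0`; if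
`r₊ < r_θ ≤ r ≤ r₊(1 + θ₁/8)` and `48S²/((r₊ − r₋)θ₁²Λ′) ≤ r_θ − r₊` then
`Δ(r_θ)·(θ₁Λ′/16)/(r² + a²)² ≤ V(r) − ω²`. [folklore] -/
theorem negCoeff_ge_of_sliverCollar (ha : |a| < M) {θ₁ : ℝ} (hθ₁ : 0 < θ₁) (hθ₁1 : θ₁ ≤ 1)
    (hBF : (1 + θ₁) * (2 * rPlus M a * ω) ^ 2 ≤ Λ - 2 * a * m * ω) (hΛ' : 0 < Λ - 2 * a * m * ω)
    {rθ r : ℝ} (hθ : rPlus M a < rθ) (hθr : rθ ≤ r) (hrθ₁ : r ≤ rPlus M a * (1 + θ₁ / 8))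
    (hx : 48 * ((rPlus M a ^ 2 + a ^ 2) * (ω - m * horizonAngularVelocity M a)) ^ 2 /
      ((rPlus M a - rMinus M a) * θ₁ ^ 2 * (Λ - 2 * a * m * ω)) ≤ rθ - rPlus M a) :
    delta M a rθ * (θ₁ * (Λ - 2 * a * m * ω) / 16) / (r ^ 2 + a ^ 2) ^ 2 ≤
      sepPotential M a ω m Λ r - ω ^ 2 := by
  have hsub : IsSubextremal M a := ha
  have hM : 0 < M := hsub.pos
  have hrp : 0 < rPlus M a := rPlus_pos hM a
  have hr : rPlus M a < r := hθ.trans_le hθr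
  have hr0 : 0 < r := hrp.trans hr
  have hA : 0 < (r ^ 2 + a ^ 2) ^ 2 := by positivity
  have h := sq_mul_negCoeff_ge_of_sliver' (ω := ω) (Λ := Λ) (m := m) ha hθ₁ hθ₁1 hBF hΛ' hr hrθ₁
    (hx.trans (by linarith))
  have hΔ : delta M a rθ ≤ delta M a r := IsTortoiseRadius.delta_le_delta hsub hθ.le hθr
  have hΔθ : 0 ≤ delta M a rθ := delta_nonneg ha.le hθ.le
  rw [div_le_iff₀ hA]
  have hc : 0 ≤ θ₁ * (Λ - 2 * a * m * ω) / 16 := by positivity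
  nlinarith [mul_le_mul_of_nonneg_right hΔ hc, h]

/-- **Outer collar floor from the fuzzed profile.** `|a| < M`, `J(r_t) = 0`,
`r₊ < r_ζ ≤ r ≤ r_lo ≤ r_t`, the lower profile bound `Δ(r)(J(r) − E) ≤ (r² + a²)²(V(r) − ω²)` at `r`,
and `E ≤ J_lo := 2ω²(r_lo + r₊)h(r_lo)(r_t − r_lo)`: then
`Δ(r_ζ)(J_lo − E)/(r_lo² + a²)² ≤ V(r) − ω²`. [folklore] -/
theorem negCoeff_ge_of_layerCollar (ha : |a| < M) {E rζ rlo rt r : ℝ} (hζ : rPlus M a < rζ)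
    (hζr : rζ ≤ r) (hrlo : r ≤ rlo) (hlot : rlo ≤ rt)
    (hJrt : Λ - 2 * a * m * ω - ω ^ 2 * (rt + rPlus M a) ^ 2 * ((rt - rPlus M a) / (rt - rMinus M a)) = 0)
    (hlow : delta M a r * (Λ - 2 * a * m * ω -
        ω ^ 2 * (r + rPlus M a) ^ 2 * ((r - rPlus M a) / (r - rMinus M a)) - E) ≤
      (r ^ 2 + a ^ 2) ^ 2 * (sepPotential M a ω m Λ r - ω ^ 2))
    (hE : E ≤ 2 * ω ^ 2 * (rlo + rPlus M a) * ((rlo - rPlus M a) / (rlo - rMinus M a)) * (rt - rlo)) :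
    delta M a rζ * (2 * ω ^ 2 * (rlo + rPlus M a) * ((rlo - rPlus M a) / (rlo - rMinus M a)) *
        (rt - rlo) - E) / (rlo ^ 2 + a ^ 2) ^ 2 ≤ sepPotential M a ω m Λ r - ω ^ 2 := by
  have hsub : IsSubextremal M a := ha
  have hM : 0 < M := hsub.pos
  have hrp : 0 < rPlus M a := rPlus_pos hM a
  have hr : rPlus M a < r := hζ.trans_le hζr
  have hrlo' : rPlus M a < rlo := hr.trans_le hrlo
  have hr0 : 0 < r := hrp.trans hr
  have hrlo0 : 0 < rlo := hrp.trans hrlo'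
  have hA : 0 < (r ^ 2 + a ^ 2) ^ 2 := by positivity
  have hAlo : 0 < (rlo ^ 2 + a ^ 2) ^ 2 := by positivity
  set J : ℝ → ℝ := fun s ↦ Λ - 2 * a * m * ω -
    ω ^ 2 * (s + rPlus M a) ^ 2 * ((s - rPlus M a) / (s - rMinus M a)) with hJdef
  set Jlo' := 2 * ω ^ 2 * (rlo + rPlus M a) * ((rlo - rPlus M a) / (rlo - rMinus M a)) * (rt - rlo)
    with hJlo'
  have h1 : Jlo' ≤ J rlo := by
    have h := thresholdProfile_sub_ge (ω := ω) (Λ := Λ) (m := m) ha hrlo' hlot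
    have e : J rt = 0 := hJrt
    simp only [hJdef] at e ⊢
    linarith [h, e]
  have h2 : J rlo ≤ J r := by
    have h := thresholdProfile_sub_ge (ω := ω) (Λ := Λ) (m := m) ha hr hrlo
    have hrm : 0 < r - rMinus M a := by linarith [hsub.rMinus_lt_rPlus]
    have h0 : 0 ≤ 2 * ω ^ 2 * (r + rPlus M a) * ((r - rPlus M a) / (r - rMinus M a)) * (rlo - r) :=
      mul_nonneg (mul_nonneg (mul_nonneg (by positivity) (by linarith))
        (div_nonneg (by linarith) hrm.le)) (by linarith)
    simp only [hJdef] at h ⊢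
    linarith
  have hJE : 0 ≤ Jlo' - E := by linarith
  have hΔζ : 0 ≤ delta M a rζ := delta_nonneg ha.le hζ.le
  have hΔ : delta M a rζ ≤ delta M a r := IsTortoiseRadius.delta_le_delta hsub hζ.le hζr
  have hlow' : delta M a r * (J r - E) ≤ (r ^ 2 + a ^ 2) ^ 2 * (sepPotential M a ω m Λ r - ω ^ 2) := hlow
  have h3 : delta M a rζ * (Jlo' - E) ≤ (r ^ 2 + a ^ 2) ^ 2 * (sepPotential M a ω m Λ r - ω ^ 2) := by
    calc delta M a rζ * (Jlo' - E) ≤ delta M a r * (J r - E) :=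
          mul_le_mul hΔ (by linarith) hJE (hΔζ.trans hΔ)
      _ ≤ _ := hlow'
  have h4 : (r ^ 2 + a ^ 2) ^ 2 ≤ (rlo ^ 2 + a ^ 2) ^ 2 :=
    pow_le_pow_left₀ (by positivity) (by nlinarith) 2
  have h5 : delta M a rζ * (Jlo' - E) / (rlo ^ 2 + a ^ 2) ^ 2 ≤
      delta M a rζ * (Jlo' - E) / (r ^ 2 + a ^ 2) ^ 2 :=
    div_le_div_of_nonneg_left (mul_nonneg hΔζ hJE) hA h4
  refine h5.trans ?_
  rw [div_le_iff₀ hA]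
  linarith

end LayerCollar

end Kerr

end Literature.Geometry.Lorentzian

end
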